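import Summits.QuantumFields.BalabanUV.Beta.BoxPoincare

/-!
# `BalabanUV.Beta.FP.ConstrainedBiLaplacianGap` — road «FP» for binder row D1, row **RHOA-4-GH (gap half)** of `LEAVES-FP.md`
# (owner d1-p3-g7, GAMMA-DESIGN v1.3 §11, journal 2026-08-21T02:00Z): «THE CONSTRAINED BI-LAPLACIAN GHOST IS GAPPED —
# `⟨λ, Δ²λ⟩ ≥ c·n⁻⁴‖λ‖²` on `ker Q′` (block Poincaré, then Cauchy–Schwarz)», AT MODEL LEVEL, with the constant EXPLICIT

HONEST DEPENDENCY (cell records, verbatim): «continuum YM on T⁴ ⇐ BetaPertH ∧ nine spine estimates (0/9 proved); BetaPertH ⇐ (D1) ∧ (D4) ∧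
CAP+tail; G-an2-4 gates asym, D1 and NE2/3/4.»  HONEST FRAMING (cell contract, verbatim): «discharging `BetaPertH` makes Bałaban's UV stability
UNCONDITIONAL — a real constructive-QFT result; it is NOT the continuum limit and NOT the Clay problem.»  THIS MODULE is [folklore] real
finite-dimensional algebra (Mathlib's discrete Cauchy–Schwarz `Finset.sum_mul_sq_le_sq_mul_sq`, `dotProduct`∕`mulVec` bookkeeping,
`Matrix.PosSemidef`) composed BY NAME with the tree's sharp-order box Poincaré inequality `Beta.BoxPoincare.variance_le` (b2b-balaban-beta-d4-p2,
MODEL).  Every operator is an ABSTRACT real matrix: `A`∕`Δ` (the role of the site Laplacian `Δ_U` at `U = 1`), an isometric kernel frame `ι`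
(`ιᵀι = 1`, the road's `GhostDeterminantModel` currency for `N(Q′) = ker Q′`), a fine index `Bk × Box d n` (blocks × in-block offsets).  The one
lattice fact used — «the Dirichlet form of `Δ` carries every IN-BLOCK bond at least once» — is a DISPLAYED letter `hdom`, NOT instantiated (on a
torus tiled by the blocks it holds for the site Laplacian, the inter-block bonds only add; that instance is a separate brick in torus currency).
NO torus, NO `Lhat`∕`Shat`∕`Nhat`, NO estimate of Bałaban's propagators, no definition, no `def … : Prop`, nothing cited, 0 sorry.  It discharges
NOTHING of `hbook`∕D1.  NOT D1, NOT BetaPertH, NOT continuum, NOT Clay.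

ABSOLUTE RULE (cell charter, verbatim): «No internally-minted statement may enter as a cited fact. Every hypothesis is either kernel-proved in this
package or a verbatim quotation of a PUBLISHED theorem with page reference. The manuscript(s) under audit are NOT citable for their own disputed
steps — they are the thing under adjudication; programme-internal (2001/route/tribunal) claims are never citable.»

THE ROW (owner, l.25075, the part proved here): «`⟨λ, Δ²λ⟩ ≥ c·n⁻⁴‖λ‖²` on `ker Q′` (block Poincaré `‖λ‖ ≤ Cn‖∇λ‖` for zero-block-mean λ
— tree: `BoxPoincare` — then Cauchy–Schwarz `⟨λ,Δλ⟩ ≤ ‖λ‖‖Δλ‖`)».  WHAT IS PROVED (all [folklore]):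
* §1 THE CAUCHY–SCHWARZ SQUARING LEMMA (any `Fintype ν`, `A : Matrix ν ν ℝ`, NO symmetry or positivity needed): `dotProduct_sq_le`
  (`(v⬝w)² ≤ (v⬝v)(w⬝w)`), `mulVec_dotProduct_mulVec` (`(Av)⬝(Bw) = v⬝((AᵀB)w)`), **`sq_gap_of_gap`** (`0 ≤ m`, `m‖v‖² ≤ ⟨v, Av⟩ ⟹
  m²‖v‖² ≤ ‖Av‖²`), **`normSq_le_sq_mul_of_le_mul`** (`0 ≤ C`, `‖v‖² ≤ C⟨v, Av⟩ ⟹ ‖v‖² ≤ C²‖Av‖²`), the symmetric read-out `‖Av‖² = ⟨v, A²v⟩`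
  (`sq_gap_of_gap_symm`), and the FRAME form for an isometric kernel frame `ι` (`ιᵀι = 1`): **`frame_sq_gap`** and its Loewner packaging
  **`posSemidef_frame_sq_sub`** `(ιᵀ(AᵀA)ι − m²•1).PosSemidef`.
* §2 BLOCK POINCARÉ ⟹ THE GAP ON ZERO-BLOCK-MEAN FUNCTIONS (fine index `Bk × Box d n`): under the letters `hmean : ∀ b, Σ_v λ(b,v) = 0` and
  `hdom : Σ_b energy(λ(b,·)) ≤ ⟨λ, Δλ⟩`: **`normSq_le_blockPoincare`** `‖λ‖² ≤ d·n·(n−1)·⟨λ, Δλ⟩`, **`biLaplacian_gap`**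
  `‖λ‖² ≤ (d·n·(n−1))²·‖Δλ‖²` (= `⟨λ, Δ²λ⟩ ≥ (d·n·(n−1))⁻²‖λ‖²`; `biLaplacian_gap_symm` writes `‖Δλ‖² = ⟨λ, Δ²λ⟩`), the row's shape
  **`biLaplacian_gap_pow_four`** `‖λ‖² ≤ d²·n⁴·‖Δλ‖²`, and the frame forms **`frame_biLaplacian_gap`** ∕ **`posSemidef_frame_biLaplacian`**
  for a kernel frame whose columns have zero block means (`(d²n⁴ • ιᵀΔᵀΔι − 1).PosSemidef`): the compressed bi-Laplacian `ιᵀΔ²ι` of the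
  ghost (`GhostDeterminantModel.ghostLogDet_eq_frame`) is INVERTIBLE with `‖(ιᵀΔ²ι)⁻¹‖ ≤ d²n⁴`, n-EXPLICITLY.
NOT HERE (honest, and LOCATED for the owner): the row's second arrow «gap ⟹ `(ιᵀΔ²ι)⁻¹` exp-localised ON SCALE n by Combes–Thomas∕WCI» does
NOT follow from this gap with n-uniform constants (Combes–Thomas rate ∝ gap∕(‖Δ²‖·range) = O(n⁻⁴) per lattice step; WCI needs `ιᵀΔ²ι =
m²(1+K)` with `‖K‖` n-uniform, here `‖K‖ ~ n⁴`): scale-n localisation of constrained inverse (bi-)Laplacians is a multiscale statement of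
the kind PRINTED in [B5] (Prop. 1.2, (1.126)–(1.127) for `(Δ + aQ′*Q′)⁻¹`; the ghost's operators are (1.26)–(1.28)) — a binder or a separate
brick, not this file.  0∕4 row-D1 binders touched.  Provenance: G-an2-4 swarm leaf seat `b2b-balaban-gan24-formalise-leaf-03` gen 45
(cross-lane duty, road «FP» row RHOA-4-GH first refusal «gan24 lineages», journal INTENT 2026-08-21T02:07Z), 2026-08-21.
-/

noncomputable section

namespace Summit.QuantumFields.BalabanUV.Beta.FP.ConstrainedBiLaplacianGap

open Matrix Finset
open Summit.QuantumFields.BalabanUV.Beta.BoxPoincare (Box energy mean energy_nonneg variance_le)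

/-! ## §1 The Cauchy–Schwarz squaring lemma -/

section CauchySchwarz

variable {ν κ : Type*} [Fintype ν] [Fintype κ] [DecidableEq κ]

omit [Fintype κ] [DecidableEq κ] in
/-- [folklore] `0 ≤ w⬝w` over `ℝ`. -/
theorem dotProduct_self_nonneg' (w : ν → ℝ) : 0 ≤ w ⬝ᵥ w :=
  Finset.sum_nonneg fun i _ => mul_self_nonneg (w i)

omit [Fintype κ] [DecidableEq κ] in
/-- [folklore] Discrete Cauchy–Schwarz in `dotProduct` currency: `(v⬝w)² ≤ (v⬝v)·(w⬝w)`. -/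
theorem dotProduct_sq_le (v w : ν → ℝ) : (v ⬝ᵥ w) ^ 2 ≤ (v ⬝ᵥ v) * (w ⬝ᵥ w) := by
  have h := Finset.sum_mul_sq_le_sq_mul_sq Finset.univ v w
  simp only [dotProduct, sq] at h ⊢
  exact h

omit [DecidableEq κ] in
/-- [folklore] `(Av)⬝(Bw) = v⬝((AᵀB)w)`. -/
theorem mulVec_dotProduct_mulVec {μ : Type*} [Fintype μ] (A : Matrix μ ν ℝ) (B : Matrix μ κ ℝ) (v : ν → ℝ) (w : κ → ℝ) :
    (A *ᵥ v) ⬝ᵥ (B *ᵥ w) = v ⬝ᵥ ((Aᵀ * B) *ᵥ w) := by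
  rw [← mulVec_mulVec, dotProduct_mulVec v Aᵀ, vecMul_transpose]

omit [Fintype κ] [DecidableEq κ] in
/-- [folklore] **THE SQUARING LEMMA**: if `0 ≤ m` and `m·‖v‖² ≤ ⟨v, Av⟩` then `m²·‖v‖² ≤ ‖Av‖²` (Cauchy–Schwarz `⟨v,Av⟩ ≤ ‖v‖‖Av‖`, then divide by
`‖v‖`; no symmetry or positivity of `A` is needed). -/
theorem sq_gap_of_gap {m : ℝ} (hm : 0 ≤ m) (A : Matrix ν ν ℝ) (v : ν → ℝ) (h : m * (v ⬝ᵥ v) ≤ v ⬝ᵥ (A *ᵥ v)) :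
    m ^ 2 * (v ⬝ᵥ v) ≤ (A *ᵥ v) ⬝ᵥ (A *ᵥ v) := by
  by_cases hv : v ⬝ᵥ v = 0
  · rw [hv, mul_zero]; exact dotProduct_self_nonneg' _
  · have hpos : 0 < v ⬝ᵥ v := lt_of_le_of_ne (dotProduct_self_nonneg' v) (Ne.symm hv)
    have h1 : (m * (v ⬝ᵥ v)) ^ 2 ≤ (v ⬝ᵥ (A *ᵥ v)) ^ 2 := pow_le_pow_left₀ (mul_nonneg hm hpos.le) h 2
    have h2 := dotProduct_sq_le v (A *ᵥ v)
    have h3 : m ^ 2 * (v ⬝ᵥ v) * (v ⬝ᵥ v) ≤ (A *ᵥ v) ⬝ᵥ (A *ᵥ v) * (v ⬝ᵥ v) := by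
      calc m ^ 2 * (v ⬝ᵥ v) * (v ⬝ᵥ v) = (m * (v ⬝ᵥ v)) ^ 2 := by ring
        _ ≤ (v ⬝ᵥ v) * ((A *ᵥ v) ⬝ᵥ (A *ᵥ v)) := h1.trans h2
        _ = (A *ᵥ v) ⬝ᵥ (A *ᵥ v) * (v ⬝ᵥ v) := by ring
    exact le_of_mul_le_mul_right h3 hpos

omit [Fintype κ] [DecidableEq κ] in
/-- [folklore] The same in «constant» form: if `‖v‖² ≤ C·⟨v, Av⟩` then `‖v‖² ≤ C²·‖Av‖²` (no sign condition on `C` is needed). -/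
theorem normSq_le_sq_mul_of_le_mul {C : ℝ} (A : Matrix ν ν ℝ) (v : ν → ℝ) (h : v ⬝ᵥ v ≤ C * (v ⬝ᵥ (A *ᵥ v))) :
    v ⬝ᵥ v ≤ C ^ 2 * ((A *ᵥ v) ⬝ᵥ (A *ᵥ v)) := by
  by_cases hv : v ⬝ᵥ v = 0
  · rw [hv]; exact mul_nonneg (sq_nonneg C) (dotProduct_self_nonneg' _)
  · have hpos : 0 < v ⬝ᵥ v := lt_of_le_of_ne (dotProduct_self_nonneg' v) (Ne.symm hv)
    have h1 : (v ⬝ᵥ v) ^ 2 ≤ (C * (v ⬝ᵥ (A *ᵥ v))) ^ 2 := pow_le_pow_left₀ hpos.le h 2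
    have h2 := dotProduct_sq_le v (A *ᵥ v)
    have h3 : (v ⬝ᵥ v) * (v ⬝ᵥ v) ≤ C ^ 2 * ((A *ᵥ v) ⬝ᵥ (A *ᵥ v)) * (v ⬝ᵥ v) := by
      calc (v ⬝ᵥ v) * (v ⬝ᵥ v) = (v ⬝ᵥ v) ^ 2 := by ring
        _ ≤ (C * (v ⬝ᵥ (A *ᵥ v))) ^ 2 := h1
        _ = C ^ 2 * (v ⬝ᵥ (A *ᵥ v)) ^ 2 := by ring
        _ ≤ C ^ 2 * ((v ⬝ᵥ v) * ((A *ᵥ v) ⬝ᵥ (A *ᵥ v))) := mul_le_mul_of_nonneg_left h2 (sq_nonneg C)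
        _ = C ^ 2 * ((A *ᵥ v) ⬝ᵥ (A *ᵥ v)) * (v ⬝ᵥ v) := by ring
    exact le_of_mul_le_mul_right h3 hpos

omit [Fintype κ] [DecidableEq κ] in
/-- [folklore] Symmetric read-out: for `Aᵀ = A`, `‖Av‖² = ⟨v, A²v⟩`, so the squaring lemma reads `m²‖v‖² ≤ ⟨v, A²v⟩`. -/
theorem sq_gap_of_gap_symm {m : ℝ} (hm : 0 ≤ m) {A : Matrix ν ν ℝ} (hA : Aᵀ = A) (v : ν → ℝ) (h : m * (v ⬝ᵥ v) ≤ v ⬝ᵥ (A *ᵥ v)) :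
    m ^ 2 * (v ⬝ᵥ v) ≤ v ⬝ᵥ ((A * A) *ᵥ v) := by
  have e : (A *ᵥ v) ⬝ᵥ (A *ᵥ v) = v ⬝ᵥ ((A * A) *ᵥ v) := by rw [mulVec_dotProduct_mulVec, hA]
  rw [← e]
  exact sq_gap_of_gap hm A v h

/-- [folklore] An isometric frame preserves the norm: `ιᵀι = 1 ⟹ ‖ιc‖² = ‖c‖²`. -/
theorem frame_normSq {ι : Matrix ν κ ℝ} (hι : ιᵀ * ι = 1) (c : κ → ℝ) : (ι *ᵥ c) ⬝ᵥ (ι *ᵥ c) = c ⬝ᵥ c := by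
  rw [mulVec_dotProduct_mulVec, hι, one_mulVec]

/-- [folklore] **THE SQUARING LEMMA THROUGH AN ISOMETRIC KERNEL FRAME** (the road's `GhostDeterminantModel` currency, `ιᵀι = 1`, columns of `ι`
spanning `N(Q′)`): a gap `m` for `⟨·, A·⟩` on the range of `ι` gives the gap `m²` for the compression `ιᵀAᵀAι`. -/
theorem frame_sq_gap {m : ℝ} (hm : 0 ≤ m) (A : Matrix ν ν ℝ) {ι : Matrix ν κ ℝ} (hι : ιᵀ * ι = 1)
    (hgap : ∀ c : κ → ℝ, m * (c ⬝ᵥ c) ≤ (ι *ᵥ c) ⬝ᵥ (A *ᵥ (ι *ᵥ c))) (c : κ → ℝ) :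
    m ^ 2 * (c ⬝ᵥ c) ≤ c ⬝ᵥ ((ιᵀ * (Aᵀ * A) * ι) *ᵥ c) := by
  have h := sq_gap_of_gap hm A (ι *ᵥ c) (by rw [frame_normSq hι]; exact hgap c)
  rw [frame_normSq hι, mulVec_mulVec, mulVec_dotProduct_mulVec, transpose_mul] at h
  calc m ^ 2 * (c ⬝ᵥ c) ≤ c ⬝ᵥ ((ιᵀ * Aᵀ * (A * ι)) *ᵥ c) := h
    _ = c ⬝ᵥ ((ιᵀ * (Aᵀ * A) * ι) *ᵥ c) := by simp only [Matrix.mul_assoc]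

/-- [folklore] Loewner packaging: under the same hypotheses `ιᵀ(AᵀA)ι − m²•1` is positive semidefinite — i.e. the compression of `AᵀA` to the
range of `ι` is bounded below by `m²`; in particular it is invertible with `‖(ιᵀAᵀAι)⁻¹‖ ≤ m⁻²` when `0 < m`. -/
theorem posSemidef_frame_sq_sub {m : ℝ} (hm : 0 ≤ m) (A : Matrix ν ν ℝ) {ι : Matrix ν κ ℝ} (hι : ιᵀ * ι = 1)
    (hgap : ∀ c : κ → ℝ, m * (c ⬝ᵥ c) ≤ (ι *ᵥ c) ⬝ᵥ (A *ᵥ (ι *ᵥ c))) :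
    (ιᵀ * (Aᵀ * A) * ι - m ^ 2 • (1 : Matrix κ κ ℝ)).PosSemidef := by
  refine PosSemidef.of_dotProduct_mulVec_nonneg ?_ fun x => ?_
  · rw [isHermitian_iff_isSymm]
    show (ιᵀ * (Aᵀ * A) * ι - m ^ 2 • (1 : Matrix κ κ ℝ))ᵀ = ιᵀ * (Aᵀ * A) * ι - m ^ 2 • (1 : Matrix κ κ ℝ)
    rw [transpose_sub, transpose_smul, transpose_one, transpose_mul, transpose_mul, transpose_mul, transpose_transpose, transpose_transpose]
    simp only [Matrix.mul_assoc]
  · have h := frame_sq_gap hm A hι hgap x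
    rw [star_trivial, sub_mulVec, dotProduct_sub, smul_mulVec, one_mulVec, dotProduct_smul, smul_eq_mul]
    linarith

end CauchySchwarz

/-! ## §2 Block Poincaré ⟹ the gap on zero-block-mean functions -/

section Blocks

variable {Bk : Type*} [Fintype Bk] {d n : ℕ}

/-- [folklore] The Poincaré constant `d·n·(n−1)` is non-negative for every natural `n` (it vanishes for `n ≤ 1`). -/
theorem poincareConst_nonneg (d n : ℕ) : (0 : ℝ) ≤ (d : ℝ) * n * ((n : ℝ) - 1) := by
  rcases Nat.eq_zero_or_pos n with h | h
  · subst h; simp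
  · have : (1 : ℝ) ≤ n := by exact_mod_cast h
    have : (0 : ℝ) ≤ (n : ℝ) - 1 := by linarith
    positivity

/-- [folklore] `‖λ‖²` over the fine index `Bk × Box d n` is the block sum of the in-block sums of squares. -/
theorem dotProduct_self_eq_sum_blocks (lam : Bk × Box d n → ℝ) :
    lam ⬝ᵥ lam = ∑ b, ∑ v, lam (b, v) ^ 2 := by
  rw [dotProduct, Fintype.sum_prod_type]
  simp only [sq]

/-- [folklore] **BLOCK POINCARÉ ON `ker Q′`**: if `λ` has ZERO MEAN on every block (`λ ∈ ker Q′`) and the Dirichlet form of `Δ` dominates the sum of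
the in-block energies (letter `hdom`), then `‖λ‖² ≤ d·n·(n−1)·⟨λ, Δλ⟩` (`BoxPoincare.variance_le` block by block). -/
theorem normSq_le_blockPoincare (Δ : Matrix (Bk × Box d n) (Bk × Box d n) ℝ) (lam : Bk × Box d n → ℝ)
    (hmean : ∀ b, ∑ v, lam (b, v) = 0)
    (hdom : ∑ b, energy (fun v => lam (b, v)) ≤ lam ⬝ᵥ (Δ *ᵥ lam)) :
    lam ⬝ᵥ lam ≤ (d : ℝ) * n * ((n : ℝ) - 1) * (lam ⬝ᵥ (Δ *ᵥ lam)) := by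
  have hblk : ∀ b, ∑ v, lam (b, v) ^ 2 ≤ (d : ℝ) * n * ((n : ℝ) - 1) * energy (fun v => lam (b, v)) := by
    intro b
    have h0 : mean (fun v => lam (b, v)) = 0 := by rw [mean, hmean b, zero_div]
    have h := variance_le (fun v => lam (b, v))
    simp only [h0, sub_zero] at h
    exact h
  calc lam ⬝ᵥ lam = ∑ b, ∑ v, lam (b, v) ^ 2 := dotProduct_self_eq_sum_blocks lam
    _ ≤ ∑ b, (d : ℝ) * n * ((n : ℝ) - 1) * energy (fun v => lam (b, v)) := sum_le_sum fun b _ => hblk b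
    _ = (d : ℝ) * n * ((n : ℝ) - 1) * ∑ b, energy (fun v => lam (b, v)) := by rw [mul_sum]
    _ ≤ (d : ℝ) * n * ((n : ℝ) - 1) * (lam ⬝ᵥ (Δ *ᵥ lam)) := mul_le_mul_of_nonneg_left hdom (poincareConst_nonneg d n)

/-- [folklore] **THE CONSTRAINED BI-LAPLACIAN GAP**: under the same two letters, `‖λ‖² ≤ (d·n·(n−1))²·‖Δλ‖²`, i.e.
`⟨λ, ΔᵀΔλ⟩ ≥ (d·n·(n−1))⁻²·‖λ‖²` on `ker Q′` — block Poincaré, then the Cauchy–Schwarz squaring lemma. -/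
theorem biLaplacian_gap (Δ : Matrix (Bk × Box d n) (Bk × Box d n) ℝ) (lam : Bk × Box d n → ℝ)
    (hmean : ∀ b, ∑ v, lam (b, v) = 0)
    (hdom : ∑ b, energy (fun v => lam (b, v)) ≤ lam ⬝ᵥ (Δ *ᵥ lam)) :
    lam ⬝ᵥ lam ≤ ((d : ℝ) * n * ((n : ℝ) - 1)) ^ 2 * ((Δ *ᵥ lam) ⬝ᵥ (Δ *ᵥ lam)) :=
  normSq_le_sq_mul_of_le_mul Δ lam (normSq_le_blockPoincare Δ lam hmean hdom)

/-- [folklore] Symmetric read-out: for `Δᵀ = Δ`, `‖λ‖² ≤ (d·n·(n−1))²·⟨λ, Δ²λ⟩`. -/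
theorem biLaplacian_gap_symm {Δ : Matrix (Bk × Box d n) (Bk × Box d n) ℝ} (hΔ : Δᵀ = Δ) (lam : Bk × Box d n → ℝ)
    (hmean : ∀ b, ∑ v, lam (b, v) = 0)
    (hdom : ∑ b, energy (fun v => lam (b, v)) ≤ lam ⬝ᵥ (Δ *ᵥ lam)) :
    lam ⬝ᵥ lam ≤ ((d : ℝ) * n * ((n : ℝ) - 1)) ^ 2 * (lam ⬝ᵥ ((Δ * Δ) *ᵥ lam)) := by
  have e : (Δ *ᵥ lam) ⬝ᵥ (Δ *ᵥ lam) = lam ⬝ᵥ ((Δ * Δ) *ᵥ lam) := by rw [mulVec_dotProduct_mulVec, hΔ]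
  rw [← e]
  exact biLaplacian_gap Δ lam hmean hdom

/-- [folklore] The row's shape `⟨λ, Δ²λ⟩ ≥ c·n⁻⁴‖λ‖²` with `c = d⁻²`: `‖λ‖² ≤ d²·n⁴·‖Δλ‖²` (since `n(n−1) ≤ n²`). -/
theorem biLaplacian_gap_pow_four (Δ : Matrix (Bk × Box d n) (Bk × Box d n) ℝ) (lam : Bk × Box d n → ℝ)
    (hmean : ∀ b, ∑ v, lam (b, v) = 0)
    (hdom : ∑ b, energy (fun v => lam (b, v)) ≤ lam ⬝ᵥ (Δ *ᵥ lam)) :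
    lam ⬝ᵥ lam ≤ (d : ℝ) ^ 2 * (n : ℝ) ^ 4 * ((Δ *ᵥ lam) ⬝ᵥ (Δ *ᵥ lam)) := by
  refine (biLaplacian_gap Δ lam hmean hdom).trans (mul_le_mul_of_nonneg_right ?_ (dotProduct_self_nonneg' _))
  have h0 := poincareConst_nonneg d n
  have h1 : (d : ℝ) * n * ((n : ℝ) - 1) ≤ (d : ℝ) * n * n := by
    have hd : (0 : ℝ) ≤ (d : ℝ) * n := by positivity
    nlinarith
  calc ((d : ℝ) * n * ((n : ℝ) - 1)) ^ 2 ≤ ((d : ℝ) * n * n) ^ 2 := pow_le_pow_left₀ h0 h1 2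
    _ = (d : ℝ) ^ 2 * (n : ℝ) ^ 4 := by ring

/-! ### §2b Frame forms on `ker Q′` -/

variable {κ : Type*} [Fintype κ] [DecidableEq κ]

omit [Fintype Bk] [DecidableEq κ] in
/-- [folklore] If every column of the frame `ι` has zero mean on every block, so does every vector `ιc` in its range. -/
theorem frame_blockMean_zero (ι : Matrix (Bk × Box d n) κ ℝ) (hιmean : ∀ (k : κ) (b : Bk), ∑ v, ι (b, v) k = 0) (c : κ → ℝ) (b : Bk) :
    ∑ v, (ι *ᵥ c) (b, v) = 0 := by
  simp only [mulVec, dotProduct]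
  rw [Finset.sum_comm]
  refine Finset.sum_eq_zero fun k _ => ?_
  rw [← Finset.sum_mul, hιmean k b, zero_mul]

omit [DecidableEq κ] in
/-- [folklore] **THE GAP THROUGH A KERNEL FRAME**: for a frame `ι` with zero-block-mean columns (columns spanning `ker Q′`) and `Δ` with the
domination letter for every vector, `‖ιc‖² ≤ (d·n·(n−1))²·‖Διc‖²` for all `c`. -/
theorem frame_biLaplacian_gap (Δ : Matrix (Bk × Box d n) (Bk × Box d n) ℝ) (ι : Matrix (Bk × Box d n) κ ℝ)
    (hιmean : ∀ (k : κ) (b : Bk), ∑ v, ι (b, v) k = 0)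
    (hdom : ∀ lam : Bk × Box d n → ℝ, ∑ b, energy (fun v => lam (b, v)) ≤ lam ⬝ᵥ (Δ *ᵥ lam)) (c : κ → ℝ) :
    (ι *ᵥ c) ⬝ᵥ (ι *ᵥ c) ≤ ((d : ℝ) * n * ((n : ℝ) - 1)) ^ 2 * ((Δ *ᵥ (ι *ᵥ c)) ⬝ᵥ (Δ *ᵥ (ι *ᵥ c))) :=
  biLaplacian_gap Δ (ι *ᵥ c) (frame_blockMean_zero ι hιmean c) (hdom _)

/-- [folklore] **LOEWNER PACKAGING FOR THE GHOST's COMPRESSED BI-LAPLACIAN**: for an ISOMETRIC frame (`ιᵀι = 1`) with zero-block-mean columns,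
`(d·n·(n−1))² • ιᵀ(ΔᵀΔ)ι − 1` is positive semidefinite — the compression `ιᵀΔ²ι` of `GhostDeterminantModel.ghostLogDet_eq_frame` (at a symmetric
`Δ`) is bounded below by `(d·n·(n−1))⁻²`, hence invertible with an n-EXPLICIT inverse bound. -/
theorem posSemidef_frame_biLaplacian (Δ : Matrix (Bk × Box d n) (Bk × Box d n) ℝ) (ι : Matrix (Bk × Box d n) κ ℝ)
    (hι : ιᵀ * ι = 1) (hιmean : ∀ (k : κ) (b : Bk), ∑ v, ι (b, v) k = 0)
    (hdom : ∀ lam : Bk × Box d n → ℝ, ∑ b, energy (fun v => lam (b, v)) ≤ lam ⬝ᵥ (Δ *ᵥ lam)) :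
    (((d : ℝ) * n * ((n : ℝ) - 1)) ^ 2 • (ιᵀ * (Δᵀ * Δ) * ι) - (1 : Matrix κ κ ℝ)).PosSemidef := by
  refine PosSemidef.of_dotProduct_mulVec_nonneg ?_ fun x => ?_
  · rw [isHermitian_iff_isSymm]
    show (((d : ℝ) * n * ((n : ℝ) - 1)) ^ 2 • (ιᵀ * (Δᵀ * Δ) * ι) - (1 : Matrix κ κ ℝ))ᵀ
        = ((d : ℝ) * n * ((n : ℝ) - 1)) ^ 2 • (ιᵀ * (Δᵀ * Δ) * ι) - (1 : Matrix κ κ ℝ)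
    rw [transpose_sub, transpose_smul, transpose_one, transpose_mul, transpose_mul, transpose_mul, transpose_transpose, transpose_transpose]
    simp only [Matrix.mul_assoc]
  · have h := frame_biLaplacian_gap Δ ι hιmean hdom x
    rw [frame_normSq hι, mulVec_mulVec, mulVec_dotProduct_mulVec, transpose_mul] at h
    have e : x ⬝ᵥ ((ιᵀ * Δᵀ * (Δ * ι)) *ᵥ x) = x ⬝ᵥ ((ιᵀ * (Δᵀ * Δ) * ι) *ᵥ x) := by simp only [Matrix.mul_assoc]
    rw [e] at h
    rw [star_trivial, sub_mulVec, dotProduct_sub, smul_mulVec, one_mulVec, dotProduct_smul, smul_eq_mul]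
    linarith

end Blocks

end Summit.QuantumFields.BalabanUV.Beta.FP.ConstrainedBiLaplacianGap

end
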